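import Summits.QuantumFields.YangMills.Theorems.ColdStartUniversalityLatticeLangevinKuwadaStep
import HarnessLib

/-!
# KUWADA'S DUALITY, abstract form: on a compact geodesic metric space, a Markov kernel with the pointwise `L²` gradient bound (constant `a`) and the
# strong Feller bound satisfies the COMMUTATION `P(Q₁ g)(x) − P g(y) ≤ a²·d(x,y)²/2` (Bakry–Gentil–Ledoux (9.7.1)), hence
# `∫φ dP(x,·) + ∫ψ dP(y,·) ≤ a²·d(x,y)²` for every Kantorovich pair `φ ⊕ ψ ≤ d²` — the dual form of `W₂(δ_x P, δ_y P) ≤ a·d(x,y)`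

Seat `ym-line-csu-p1` (g42), route `ColdStartUniversality` of `Summits/QuantumFields/YangMills`, helper file G64b (`--supports stmt-QuantumFields-24809`).
GENERIC (instantiated in the sequel with `X = SU(2)^E`, `ρ_L`, the `SU(2)` lattice Langevin kernel `κ_t` and `a = e^(−(1−12|β'|)t)`).  From the step
estimate of G64a (`kuwada_step`): telescoping over a partition of `[s₀, 1]` of mesh `δ` leaves an error `(1−s₀)·√δ·K → 0`; then `s₀ → 0` using
`Q_{s₀} g ≤ g` and the strong Feller bound once more.

* ★ `sub_le_of_step_bound` — real-variable telescoping: `h(s') − h(s) ≤ (s'−s)C + (s'−s)^{3/2}K` on `[s₀,1]` ⇒ `h(1) − h(s₀) ≤ (1−s₀)C`;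
* ★★★ `kuwada_hopfLax_commutation` — `∫Q₁g dκ(x) − ∫g dκ(y) ≤ a²·d(x,y)²/2` for every Lipschitz `g` (BGL Prop. 9.7.1 (ii) for the kernel `κ`);
* ★★★ `kuwada_duality_pairs` — `∫φ dκ(x) + ∫ψ dκ(y) ≤ a²·d(x,y)²` for continuous `φ ⊕ ψ ≤ d²` (Lipschitz `c`-transform of `ψ`, G62).

THEOREMS ONLY, no definition, no sorry.  HONEST FRAMING: abstract metric-measure lemmas; nothing here is specific to Yang–Mills; no crux, rung or
summit statement is proved; the Yang–Mills mass gap is NOT proved.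
-/

set_option autoImplicit false

noncomputable section

namespace Summit.QuantumFields.YangMills.Theorems.ColdStartUniversality

open MeasureTheory ProbabilityTheory Filter Topology Set Metric
open scoped BigOperators

/-! ## §1. Telescoping -/

/-- ★ **Telescoping with a superlinear error.**  If `h(s') − h(s) ≤ (s'−s)·C + (s'−s)·√(s'−s)·K` whenever `s₀ ≤ s ≤ s' ≤ 1`,
`s₀ ≤ 1`, then `h(1) − h(s₀) ≤ (1 − s₀)·C` (sum over a partition of mesh `δ`: the error is `(1−s₀)√δ·K → 0`). [folklore] -/
theorem sub_le_of_step_bound {h : ℝ → ℝ} {s₀ C K : ℝ} (hs₀1 : s₀ ≤ 1)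
    (hstep : ∀ s s' : ℝ, s₀ ≤ s → s ≤ s' → s' ≤ 1 → h s' - h s ≤ (s' - s) * C + (s' - s) * Real.sqrt (s' - s) * K) :
    h 1 - h s₀ ≤ (1 - s₀) * C := by
  have h1s : 0 ≤ 1 - s₀ := by linarith
  -- the bound with `n+1` steps
  have hn : ∀ n : ℕ, h 1 - h s₀ ≤ (1 - s₀) * C + (1 - s₀) * Real.sqrt ((1 - s₀) / ((n : ℝ) + 1)) * K := by
    intro n
    obtain ⟨δ, hδ⟩ : ∃ δ : ℝ, δ = (1 - s₀) / ((n : ℝ) + 1) := ⟨_, rfl⟩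
    have hδ0 : 0 ≤ δ := by rw [hδ]; positivity
    have hnδ : ((n : ℝ) + 1) * δ = 1 - s₀ := by rw [hδ]; field_simp
    have P : ∀ k : ℕ, k ≤ n + 1 → h (s₀ + (k : ℝ) * δ) - h s₀ ≤ (k : ℝ) * δ * C + (k : ℝ) * δ * Real.sqrt δ * K := by
      intro k
      induction k with
      | zero => intro _; simp
      | succ k ih =>
        intro hk
        have hk' : k ≤ n + 1 := Nat.le_of_succ_le hk
        have h0 := ih hk'
        have hkle : ((k : ℝ) + 1) ≤ (n : ℝ) + 1 := by exact_mod_cast hk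
        have hs1 : s₀ ≤ s₀ + (k : ℝ) * δ := by nlinarith [(Nat.cast_nonneg k : (0 : ℝ) ≤ k)]
        have hs2 : s₀ + (k : ℝ) * δ ≤ s₀ + ((k : ℝ) + 1) * δ := by nlinarith
        have hs3 : s₀ + ((k : ℝ) + 1) * δ ≤ 1 := by nlinarith
        have h1 := hstep _ _ hs1 hs2 hs3
        have e : s₀ + ((k : ℝ) + 1) * δ - (s₀ + (k : ℝ) * δ) = δ := by ring
        rw [e] at h1
        push_cast
        linarith
    have h2 := P (n + 1) le_rfl
    have e1 : s₀ + ((n + 1 : ℕ) : ℝ) * δ = 1 := by push_cast; linarith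
    have e2 : ((n + 1 : ℕ) : ℝ) * δ = 1 - s₀ := by push_cast; linarith
    rw [e1, e2] at h2
    rw [← hδ]
    exact h2
  -- `n → ∞`
  have hlim : Tendsto (fun n : ℕ => (1 - s₀) * C + (1 - s₀) * Real.sqrt ((1 - s₀) / ((n : ℝ) + 1)) * K) atTop (𝓝 ((1 - s₀) * C + (1 - s₀) * Real.sqrt 0 * K)) := by
    have h1 : Tendsto (fun n : ℕ => (1 - s₀) / ((n : ℝ) + 1)) atTop (𝓝 0) := by
      have := tendsto_one_div_add_atTop_nhds_zero_nat.const_mul (1 - s₀)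
      rw [mul_zero] at this
      refine this.congr fun n => ?_
      field_simp
    exact tendsto_const_nhds.add ((h1.sqrt.const_mul (1 - s₀)).mul_const K)
  rw [Real.sqrt_zero, mul_zero, zero_mul, add_zero] at hlim
  exact ge_of_tendsto' hlim hn

/-! ## §2. The commutation inequality `P(Q₁g)(x) − Pg(y) ≤ a²d(x,y)²/2` -/

variable {X : Type*} [MetricSpace X] [CompactSpace X] [MeasurableSpace X] [BorelSpace X]

/-- ★★★ **Kuwada's commutation inequality (Bakry–Gentil–Ledoux (9.7.1) for a kernel).**  Let `κ` be a Markov kernel on a compact metric space with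
geodesic interpolation, satisfying the pointwise `L²` gradient bound with constant `a` for Lipschitz observables (hypothesis (a)) and the strong
Feller bound (b).  Then for every Lipschitz `g` and all `x, y`:  `∫Q₁g dκ(x) − ∫g dκ(y) ≤ a²·d(x,y)²/2`.
[cite: BakryGentilLedoux2014, Prop 9.7.1 / Thm 9.7.2] -/
theorem kuwada_hopfLax_commutation (κ : Kernel X X) [IsMarkovKernel κ] {a b : ℝ} (ha : 0 ≤ a) (hb : 0 ≤ b)
    (hSF : ∀ (G : X → ℝ) (M : ℝ), UpperSemicontinuous G → (∀ z, 0 ≤ G z) → (∀ z, G z ≤ M) →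
      ∀ x x' : X, |∫ y, G y ∂(κ x') - ∫ y, G y ∂(κ x)| ≤ b * M * dist x x')
    (hG2 : ∀ (F : X → ℝ) (Lf : ℝ), 0 ≤ Lf → (∀ z z' : X, |F z' - F z| ≤ Lf * dist z z') → ∀ (R : ℝ), 0 < R →
      ∀ (G : X → ℝ) (M : ℝ), Measurable G → (∀ w, 0 ≤ G w) → (∀ w, G w ≤ M) →
      (∀ w z' z'' : X, dist w z' ≤ R → dist w z'' ≤ R → |F z'' - F z'| ≤ G w * dist z' z'') →
      ∀ (x x' : X) (S : ℝ), (∀ z : X, dist x z ≤ dist x x' → ∫ y, G y ^ 2 ∂(κ z) ≤ S) →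
        |∫ y, F y ∂(κ x') - ∫ y, F y ∂(κ x)| ≤ a * Real.sqrt S * dist x x')
    (hgeo : ∀ x y : X, ∃ γ : ℝ → X, γ 0 = y ∧ γ 1 = x ∧
      ∀ s s' : ℝ, s ∈ Set.Icc (0 : ℝ) 1 → s' ∈ Set.Icc (0 : ℝ) 1 → dist (γ s) (γ s') ≤ |s - s'| * dist x y)
    {g : X → ℝ} (hg : Continuous g) {Lg : ℝ} (hLg : 0 ≤ Lg) (hlip : ∀ z w, |g z - g w| ≤ Lg * dist z w) (x y : X) :
    ∫ w, (⨅ v, (g v + dist w v ^ 2 / (2 * 1))) ∂(κ x) - ∫ w, g w ∂(κ y) ≤ a ^ 2 / 2 * dist x y ^ 2 := by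
  obtain ⟨γ, hγ0, hγ1, hγ⟩ := hgeo x y
  obtain ⟨ρ, hρ⟩ : ∃ ρ : ℝ, ρ = dist x y := ⟨_, rfl⟩
  have hρ0 : 0 ≤ ρ := by rw [hρ]; exact dist_nonneg
  rw [← hρ] at hγ ⊢
  -- a sup bound for `g`
  obtain ⟨Mg, hMg'⟩ := (isCompact_range (continuous_abs.comp hg)).bddAbove
  have hMg : ∀ w, |g w| ≤ Mg := fun w => hMg' ⟨w, rfl⟩
  have hMg0 : 0 ≤ Mg := (abs_nonneg _).trans (hMg x)
  -- integrability of `g`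
  have hgi : ∀ u : X, Integrable g (κ u) := fun u => hg.integrable_of_hasCompactSupport (HasCompactSupport.of_compactSpace g)
  refine le_of_forall_pos_le_add fun ε hε => ?_
  -- choose `s₀`
  obtain ⟨s₀, hs₀def⟩ : ∃ s₀ : ℝ, s₀ = min 1 (ε / (2 * b * Mg * ρ + 1)) := ⟨_, rfl⟩
  have hs₀ : 0 < s₀ := by rw [hs₀def]; exact lt_min one_pos (div_pos hε (by positivity))
  have hs₀1 : s₀ ≤ 1 := by rw [hs₀def]; exact min_le_left _ _
  have hs₀ε : s₀ * (2 * b * Mg * ρ) ≤ ε := by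
    have h1 : s₀ ≤ ε / (2 * b * Mg * ρ + 1) := by rw [hs₀def]; exact min_le_right _ _
    have h2 := (le_div_iff₀ (by positivity : (0 : ℝ) < 2 * b * Mg * ρ + 1)).1 h1
    nlinarith
  -- the function `h(s) = ∫Q_s g dκ(γ_s)` and its step bound on `[s₀, 1]`
  have hstep : ∀ s s' : ℝ, s₀ ≤ s → s ≤ s' → s' ≤ 1 →
      (fun s => ∫ w, (⨅ v, (g v + dist w v ^ 2 / (2 * s))) ∂(κ (γ s))) s' - (fun s => ∫ w, (⨅ v, (g v + dist w v ^ 2 / (2 * s))) ∂(κ (γ s))) s ≤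
        (s' - s) * (a ^ 2 * ρ ^ 2 / 2) + (s' - s) * Real.sqrt (s' - s) * (2 * Lg ^ 2 / s₀ + 2 * b * Lg ^ 2 * ρ + 2 * a * Lg * ρ * Real.sqrt (b * ρ)) := by
    intro s s' h1 h2 h3
    have hsI : s ∈ Set.Icc (0 : ℝ) 1 := ⟨by linarith, by linarith⟩
    have hs'I : s' ∈ Set.Icc (0 : ℝ) 1 := ⟨by linarith, by linarith⟩
    have hd : dist (γ s) (γ s') ≤ (s' - s) * ρ := by
      have h := hγ s s' hsI hs'I
      rwa [abs_sub_comm, abs_of_nonneg (by linarith : (0 : ℝ) ≤ s' - s)] at h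
    exact kuwada_step κ ha hb hSF hG2 hg hLg hlip hs₀ h1 h2 h3 hρ0 (γ s) (γ s') hd
  have htel := sub_le_of_step_bound (h := fun s => ∫ w, (⨅ v, (g v + dist w v ^ 2 / (2 * s))) ∂(κ (γ s))) hs₀1 hstep
  simp only [hγ1] at htel
  -- `h(s₀) ≤ ∫ g dκ(γ s₀) ≤ ∫ g dκ(y) + 2bM_g·s₀ρ`
  have hQle : ∫ w, (⨅ v, (g v + dist w v ^ 2 / (2 * s₀))) ∂(κ (γ s₀)) ≤ ∫ w, g w ∂(κ (γ s₀)) :=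
    integral_mono ((hopfLax_continuous hg hLg hlip hs₀).integrable_of_hasCompactSupport (HasCompactSupport.of_compactSpace _)) (hgi _)
      fun w => hopfLax_le_self hg s₀ w
  have hmove : ∫ w, g w ∂(κ (γ s₀)) ≤ ∫ w, g w ∂(κ y) + 2 * b * Mg * (s₀ * ρ) := by
    have husc : UpperSemicontinuous fun w => g w + Mg := (hg.add continuous_const).upperSemicontinuous
    have h0 : ∀ w, 0 ≤ g w + Mg := fun w => by have := hMg w; rw [abs_le] at this; linarith
    have h2 : ∀ w, g w + Mg ≤ 2 * Mg := fun w => by have := hMg w; rw [abs_le] at this; linarith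
    have h3 := hSF _ (2 * Mg) husc h0 h2 y (γ s₀)
    have hshift : ∀ u : X, ∫ w, (g w + Mg) ∂(κ u) = ∫ w, g w ∂(κ u) + Mg := fun u => by
      rw [integral_add (hgi u) (integrable_const Mg), integral_const, probReal_univ, one_smul]
    rw [hshift, hshift] at h3
    have hd : dist y (γ s₀) ≤ s₀ * ρ := by
      have h := hγ 0 s₀ ⟨le_rfl, zero_le_one⟩ ⟨hs₀.le, hs₀1⟩
      rwa [hγ0, zero_sub, abs_neg, abs_of_pos hs₀] at h
    have h4 : b * (2 * Mg) * dist y (γ s₀) ≤ b * (2 * Mg) * (s₀ * ρ) := mul_le_mul_of_nonneg_left hd (by positivity)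
    have h5 := (abs_le.1 h3).2
    linarith
  have h1s : (1 - s₀) * (a ^ 2 * ρ ^ 2 / 2) ≤ a ^ 2 / 2 * ρ ^ 2 := by
    have : 0 ≤ s₀ * (a ^ 2 * ρ ^ 2 / 2) := by positivity
    linarith
  linarith

/-! ## §3. The dual form of the `W₂` contraction -/

/-- ★★★ **Kuwada's duality, Kantorovich form.**  Under the hypotheses of `kuwada_hopfLax_commutation`: for all continuous `φ, ψ` with
`φ(u) + ψ(v) ≤ d(u,v)²` and all `x, y`,  `∫φ dκ(x) + ∫ψ dκ(y) ≤ a²·d(x,y)²`.  With Kantorovich duality this is `W₂(κ(x,·), κ(y,·)) ≤ a·d(x,y)`.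
[cite: BakryGentilLedoux2014, Thm 9.7.2] -/
theorem kuwada_duality_pairs (κ : Kernel X X) [IsMarkovKernel κ] {a b : ℝ} (ha : 0 ≤ a) (hb : 0 ≤ b)
    (hSF : ∀ (G : X → ℝ) (M : ℝ), UpperSemicontinuous G → (∀ z, 0 ≤ G z) → (∀ z, G z ≤ M) →
      ∀ x x' : X, |∫ y, G y ∂(κ x') - ∫ y, G y ∂(κ x)| ≤ b * M * dist x x')
    (hG2 : ∀ (F : X → ℝ) (Lf : ℝ), 0 ≤ Lf → (∀ z z' : X, |F z' - F z| ≤ Lf * dist z z') → ∀ (R : ℝ), 0 < R →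
      ∀ (G : X → ℝ) (M : ℝ), Measurable G → (∀ w, 0 ≤ G w) → (∀ w, G w ≤ M) →
      (∀ w z' z'' : X, dist w z' ≤ R → dist w z'' ≤ R → |F z'' - F z'| ≤ G w * dist z' z'') →
      ∀ (x x' : X) (S : ℝ), (∀ z : X, dist x z ≤ dist x x' → ∫ y, G y ^ 2 ∂(κ z) ≤ S) →
        |∫ y, F y ∂(κ x') - ∫ y, F y ∂(κ x)| ≤ a * Real.sqrt S * dist x x')
    (hgeo : ∀ x y : X, ∃ γ : ℝ → X, γ 0 = y ∧ γ 1 = x ∧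
      ∀ s s' : ℝ, s ∈ Set.Icc (0 : ℝ) 1 → s' ∈ Set.Icc (0 : ℝ) 1 → dist (γ s) (γ s') ≤ |s - s'| * dist x y)
    {φ ψ : X → ℝ} (hφ : Continuous φ) (hψ : Continuous ψ) (h : ∀ u v : X, φ u + ψ v ≤ dist u v ^ 2) (x y : X) :
    ∫ w, φ w ∂(κ x) + ∫ w, ψ w ∂(κ y) ≤ a ^ 2 * dist x y ^ 2 := by
  -- a diameter bound and the Lipschitz `c`-transform of `ψ`
  have hΔ : ∀ u v : X, dist u v ≤ Metric.diam (Set.univ : Set X) := fun u v =>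
    Metric.dist_le_diam_of_mem isCompact_univ.isBounded (Set.mem_univ u) (Set.mem_univ v)
  obtain ⟨ψ', hψψ', hφψ', hlipψ', hcψ'⟩ := exists_lipschitz_potential h hΔ
  have hΔ0 : 0 ≤ Metric.diam (Set.univ : Set X) := Metric.diam_nonneg
  -- `g = −ψ'/2`
  have hgc : Continuous fun w => -(ψ' w) / 2 := (hcψ'.neg).div_const 2
  have hglip : ∀ z w : X, |(-(ψ' z) / 2) - (-(ψ' w) / 2)| ≤ Metric.diam (Set.univ : Set X) * dist z w := by
    intro z w
    have h1 := hlipψ' w z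
    rw [dist_comm] at h1
    rw [show (-(ψ' z) / 2) - (-(ψ' w) / 2) = (ψ' w - ψ' z) / 2 by ring, abs_div, abs_two]
    linarith
  have hmain := kuwada_hopfLax_commutation κ ha hb hSF hG2 hgeo hgc hΔ0 hglip x y
  -- `φ/2 ≤ Q₁(−ψ'/2)`, `ψ ≤ ψ'`
  have hφi : Integrable φ (κ x) := hφ.integrable_of_hasCompactSupport (HasCompactSupport.of_compactSpace φ)
  have hψi : Integrable ψ (κ y) := hψ.integrable_of_hasCompactSupport (HasCompactSupport.of_compactSpace ψ)
  have hψ'i : Integrable ψ' (κ y) := hcψ'.integrable_of_hasCompactSupport (HasCompactSupport.of_compactSpace ψ')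
  have hQi : Integrable (fun w => ⨅ v, (-(ψ' v) / 2 + dist w v ^ 2 / (2 * 1))) (κ x) :=
    (hopfLax_continuous hgc hΔ0 hglip one_pos).integrable_of_hasCompactSupport (HasCompactSupport.of_compactSpace _)
  have h1 : ∫ w, φ w ∂(κ x) ≤ 2 * ∫ w, (⨅ v, (-(ψ' v) / 2 + dist w v ^ 2 / (2 * 1))) ∂(κ x) := by
    rw [← integral_const_mul]
    refine integral_mono hφi (hQi.const_mul 2) fun w => ?_
    have := half_le_hopfLax_one hφψ' w
    show φ w ≤ 2 * ⨅ v, (-(ψ' v) / 2 + dist w v ^ 2 / (2 * 1))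
    linarith
  have h2 : ∫ w, ψ w ∂(κ y) ≤ ∫ w, ψ' w ∂(κ y) := integral_mono hψi hψ'i hψψ'
  have h3 : ∫ w, (-(ψ' w) / 2) ∂(κ y) = -(∫ w, ψ' w ∂(κ y)) / 2 := by
    rw [show (fun w => -(ψ' w) / 2) = fun w => (-1 / 2) * ψ' w by funext w; ring, integral_const_mul]; ring
  rw [h3] at hmain
  linarith

end Summit.QuantumFields.YangMills.Theorems.ColdStartUniversality

end
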